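import Summits.MatrixMultiplication.MatrixMultiplication.Theorems.NilpotentLieHostsUnitriangularCostShapeModelLevelTheorem

/-!
# `UnitriangularCostShape` — Product model, part 8: the product formula for slices and weight bookkeeping

Crux `stmt-MatrixMultiplication-7724` (`NilpotentLieHosts.UnitriangularCostShape`), line `registered`
(`Cruxes/UnitriangularCostShape/Lines/birth.lean`), stub `stub_productModel` (the Weyl-type product model of
`U(u_d)/I^(s+1)` over the truncated Casimir algebra, `b = k = ⌊d/2⌋`).  Helper vocabulary and lemmas, namespace
`…Theorems.UnitriangularCostShape.ProductModel`.

`level_mul_slice` (level coefficient times a deeper slice is the combined slice), weights of the level data,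
`weight_shellL_add` (balance of the shell).
-/

set_option linter.dupNamespace false

noncomputable section

namespace Summit.MatrixMultiplication.MatrixMultiplication.Theorems.UnitriangularCostShape.ProductModel

open MvPolynomial
open scoped BigOperators Pointwise

variable {d : ℕ}

/-- The family `VS` is monotone. -/
theorem vs_mono {t t' : Set (Var d)} (h : t ⊆ t') : VS (d := d) t ⊆ VS t' :=
  fun _ hx u hu => h (hx u hu)

/-- The exponential factor off column `j`. -/
def ELc (K : ℕ) (j : Fin d) : MvPolynomial (Var d) (A d) :=
  ∏ u ∈ Finset.univ.filter (fun u : Var d => ¬ u.col = j), expK K (C (Xmat d u.row u.col) * X u)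

/-- The exponential factor splits into its column-`j` part and the rest. -/
theorem Eprod_eq_EL_mul (K : ℕ) (j : Fin d) : Eprod K (Xmat d) = EL K j * ELc K j := by
  unfold Eprod EL ELc LV
  rw [Finset.prod_filter_mul_prod_filter_not]

/-- The exponential factor off column `j` has no column-`j` variables. -/
theorem jsupp_ELc_vs (K : ℕ) (j : Fin d) : JSupp (ELc (d := d) K j) ⊆ VS {u | ¬ u.col = j} := by
  unfold ELc
  refine (jsupp_prod_expK_subset_vs K _).trans (vs_mono ?_)
  intro u hu
  simpa using hu

/-- The exponential factor of column `j` only has column-`j` variables. -/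
theorem jsupp_EL_vs (K : ℕ) (j : Fin d) : JSupp (EL (d := d) K j) ⊆ VS {u | u.col = j} := by
  unfold EL
  refine (jsupp_prod_expK_subset_vs K _).trans (vs_mono ?_)
  intro u hu
  simpa [LV] using hu

/-- The slice with empty data is `1`. -/
theorem Slice_zero_zero {K : ℕ} (hK : 1 ≤ K) : Slice (d := d) K 0 0 = 1 := by
  unfold Slice
  rw [show (monomial (0 : Var d →₀ ℕ) (1 : A d)) = 1 from rfl, map_one, mul_one]
  exact coeff_zero_prod_expK hK _

/-- **Product formula.** The level-`j` coefficient times a slice with data off column `j` is the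
slice of the combined data. -/
theorem level_mul_slice {K : ℕ} (hK : 1 ≤ K) (j : Fin d) (hj : d ≤ 2 * (j : ℕ)) (β : Fin d × Fin d →₀ ℕ)
    (α' γ' : Var d →₀ ℕ) (hα' : ∀ u ∈ α'.support, ¬ u.col = j) (hγ' : ∀ u ∈ γ'.support, ¬ u.col = j) :
    coeff (gamL j β) (EL K j * sigma (Xmat d) (monomial (epsL j β) 1)) * Slice K α' γ' =
      Slice K (epsL j β + α') (gamL j β + γ') := by
  classical
  have hQ : JSupp (ELc K j * sigma (Xmat d) (monomial α' 1)) ⊆ VS {u | ¬ u.col = j} :=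
    jsupp_mul_subset_vs (jsupp_ELc_vs K j)
      (jsupp_sigma_monomial_subset_vs _ (fun u u' hu h => by simp only [Set.mem_setOf_eq] at hu ⊢; rwa [h]) α' hα')
  have hP : JSupp (EL K j * sigma (Xmat d) (monomial (epsL j β) 1)) ⊆ VS {u | u.col = j} :=
    (jsupp_level K j hj β).trans fun x hx => hx.2.2.1
  have hfilt1 : (gamL j β + γ').filter (fun u => u.col = j) = gamL j β := by
    ext u
    rw [Finsupp.filter_apply, Finsupp.add_apply]
    by_cases h : u.col = j
    · rw [if_pos h]
      have : γ' u = 0 := by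
        by_contra h'; exact hγ' u (Finsupp.mem_support_iff.mpr h') h
      rw [this, add_zero]
    · rw [if_neg h, gamL_apply, if_neg h]
  have hfilt2 : (gamL j β + γ').filter (fun u => ¬ u.col = j) = γ' := by
    ext u
    rw [Finsupp.filter_apply, Finsupp.add_apply]
    by_cases h : u.col = j
    · rw [if_neg (not_not_intro h)]
      by_contra h'; exact hγ' u (Finsupp.mem_support_iff.mpr (Ne.symm h')) h
    · rw [if_pos h, gamL_apply, if_neg h, zero_add]
  have hfilt3 : γ'.filter (fun u => u.col = j) = 0 := by
    ext u
    rw [Finsupp.filter_apply]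
    split_ifs with h
    · by_contra h'; exact hγ' u (Finsupp.mem_support_iff.mpr h') h
    · rfl
  have hfilt4 : γ'.filter (fun u => ¬ u.col = j) = γ' := by
    ext u
    rw [Finsupp.filter_apply]
    split_ifs with h
    · by_contra h'; exact hγ' u (Finsupp.mem_support_iff.mpr (Ne.symm h')) h
    · rfl
  -- the combined slice
  have e1 : Slice K (epsL j β + α') (gamL j β + γ') =
      coeff (gamL j β + γ') ((EL K j * sigma (Xmat d) (monomial (epsL j β) 1)) *
        (ELc K j * sigma (Xmat d) (monomial α' 1))) := by
    unfold Slice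
    rw [Eprod_eq_EL_mul K j, show monomial (epsL j β + α') (1 : A d) =
      monomial (epsL j β) 1 * monomial α' 1 by rw [monomial_mul, one_mul], map_mul, mul_mul_mul_comm]
  have e2 : Slice K α' γ' = coeff γ' (ELc K j * sigma (Xmat d) (monomial α' 1)) := by
    unfold Slice
    rw [Eprod_eq_EL_mul K j, mul_assoc, coeff_mul_of_disjoint (fun u => u.col = j) (jsupp_EL_vs K j) hQ,
      hfilt3, hfilt4]
    unfold EL
    rw [coeff_zero_prod_expK hK, one_mul]
  rw [e1, coeff_mul_of_disjoint (fun u => u.col = j) hP hQ, hfilt1, hfilt2, e2]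

/-! ### Weights of the level data -/

/-- Weight of a scaled unit vector. -/
theorem weight_smul_single (p : Fin d × Fin d) (c : ℕ) :
    Finsupp.weight xw (c • Finsupp.single p 1) = c * xw p := by
  rw [map_nsmul, Finsupp.weight_single, smul_eq_mul, smul_eq_mul, one_mul]

/-- Weight of the shell part. -/
theorem weight_shellL (j : Fin d) (β : Fin d × Fin d →₀ ℕ) :
    Finsupp.weight xw (shellL j β) =
      (∑ u : Var d, if u.col = j ∧ lo j < u.row then β (lo j, u.row) * xw (lo j, u.row) else 0) +
      ∑ u : Var d, if u.col = j then β (u.row, j) * xw (u.row, j) else 0 := by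
  unfold shellL
  rw [map_add, map_sum, map_sum]
  congr 1 <;> refine Finset.sum_congr rfl fun u _ => ?_ <;> split_ifs <;>
    simp [Finsupp.weight_single, mul_comm]

/-- The test exponent weighs at most `(d - 2)` times the shell. -/
theorem weight_epsL_le (j : Fin d) (β : Fin d × Fin d →₀ ℕ) :
    Finsupp.weight Var.wt (epsL j β) ≤ (d - 2) * Finsupp.weight xw (shellL j β) := by
  rw [weight_epsL, weight_shellL, mul_add]
  refine le_trans ?_ (Nat.le_add_right _ _)
  unfold QV
  rw [Finset.sum_filter, Finset.mul_sum]
  refine Finset.sum_le_sum fun u _ => ?_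
  split_ifs with h
  · have h1 : u.wt ≤ d - 2 := by
      unfold Var.wt
      have := u.row_lt_col
      have h2 : (lo j : ℕ) < u.row := h.2
      rw [lo_val] at h2
      have h3 : (u.col : ℕ) < d := u.col.2
      rw [h.1] at h3 ⊢
      omega
    have h2 : 1 ≤ xw (lo j, u.row) := by
      unfold xw
      have h2 : (lo j : ℕ) < u.row := h.2
      simp only
      omega
    calc β (lo j, u.row) * u.wt ≤ β (lo j, u.row) * (d - 2) := Nat.mul_le_mul_left _ h1
      _ = (d - 2) * (β (lo j, u.row) * 1) := by ring
      _ ≤ (d - 2) * (β (lo j, u.row) * xw (lo j, u.row)) :=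
        Nat.mul_le_mul_left _ (Nat.mul_le_mul_left _ h2)
  · simp

/-- The main term has `x^{shell}` in its joint support, whence the weight balance of the shell. -/
theorem weight_shellL_add (K : ℕ) (j : Fin d) (hj : d ≤ 2 * (j : ℕ)) (β : Fin d × Fin d →₀ ℕ)
    (hK : ∀ p, β p < K) :
    Finsupp.weight xw (shellL j β) + Finsupp.weight Var.wt (epsL j β) =
      Finsupp.weight Var.wt (gamL j β) := by
  classical
  have hJ : JSupp (EL K j * ∏ u ∈ QV j, (Aterm j hj u) ^ β (lo j, u.row)) ⊆
      GR j (Finsupp.weight Var.wt (epsL j β), rhoL j β) := by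
    have h1 := jsupp_prod_subset (QV j) (GR j) (gr_add j) (zero_mem_gr j)
      (a := fun u => β (lo j, u.row) • (u.wt, 1))
      (P := fun u => (Aterm j hj u) ^ β (lo j, u.row)) fun u hu => by
        rw [mem_QV] at hu
        exact jsupp_pow_subset (GR j) (gr_add j) (zero_mem_gr j) (jsupp_Aterm j hj hu.1 hu.2) _
    have e : (∑ u ∈ QV j, β (lo j, u.row) • ((u.wt, 1) : ℕ × ℕ)) =
        (Finsupp.weight Var.wt (epsL j β), rhoL j β) := by
      rw [weight_epsL, rhoL_eq_sum]
      ext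
      · rw [Prod.fst_sum]; simp
      · rw [Prod.snd_sum]; simp
    rw [e] at h1
    have := jsupp_mul_subset (GR j) (gr_add j) (jsupp_EL K j) h1
    simpa using this
  have hmem : (shellL j β, gamL j β) ∈ JSupp (EL K j * ∏ u ∈ QV j, (Aterm j hj u) ^ β (lo j, u.row)) := by
    rw [mem_jsupp]
    simp only
    rw [main_term K j hj β hK, IsScalarTower.algebraMap_apply ℚ ℂ (A d), MvPolynomial.algebraMap_eq,
      C_mul_monomial, mul_one, coeff_monomial, if_pos rfl]
    rw [map_ne_zero_iff _ (algebraMap ℚ ℂ).injective]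
    exact Finset.prod_ne_zero_iff.mpr fun u _ => inv_ne_zero (Nat.cast_ne_zero.mpr (Nat.factorial_ne_zero _))
  exact (hJ hmem).1

/-- The output exponent weighs at most `(d - 1)` times the shell. -/
theorem weight_gamL_le (K : ℕ) (j : Fin d) (hj : d ≤ 2 * (j : ℕ)) (β : Fin d × Fin d →₀ ℕ)
    (hK : ∀ p, β p < K) :
    Finsupp.weight Var.wt (gamL j β) ≤ (d - 1) * Finsupp.weight xw (shellL j β) := by
  rw [← weight_shellL_add K j hj β hK]
  have := weight_epsL_le j β
  have h2 : (d - 2) * Finsupp.weight xw (shellL j β) + Finsupp.weight xw (shellL j β) ≤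
      (d - 1) * Finsupp.weight xw (shellL j β) := by
    rw [← Nat.succ_mul]
    refine Nat.mul_le_mul_right _ ?_
    omega
  omega

/-- Landing hook of part 8: the product formula for slices. -/
theorem stub_pm_sliceProduct : ∀ (d K : ℕ), 1 ≤ K → ∀ (j : Fin d), d ≤ 2 * (j : ℕ) → ∀ (β : Fin d × Fin d →₀ ℕ) (α' γ' : Var d →₀ ℕ), (∀ u ∈ α'.support, ¬ u.col = j) → (∀ u ∈ γ'.support, ¬ u.col = j) → MvPolynomial.coeff (gamL j β) (EL K j * sigma (Xmat d) (MvPolynomial.monomial (epsL j β) 1)) * Slice K α' γ' = Slice K (epsL j β + α') (gamL j β + γ') :=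
  fun _ _ hK j hj β α' γ' hα hγ => level_mul_slice hK j hj β α' γ' hα hγ

end Summit.MatrixMultiplication.MatrixMultiplication.Theorems.UnitriangularCostShape.ProductModel
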